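import Literature.IUT.HodgeTheaters.GoodLocalFrobenioidOfGalois
import Literature.AlgebraicGeometry.Frobenioids.Thm34SubClosers2
import Literature.AlgebraicGeometry.Frobenioids.PadicFrobenioidStandardType
import Literature.AlgebraicGeometry.Frobenioids.ModelFrobenioidTypeBridge
import Literature.AnabelianGeometry.SemiGraphs.CosetCategoriesFSM
import Literature.AlgebraicGeometry.Frobenioids.PadicFrobenioidDZeroSlim
import HarnessLib

/-!
# [IUTchI] Example 3.3 (iii) (b)(c) at the REAL instances `GoodLocalFrobenioid.ofKit` / `ofGalois`, from [FrdI] Theorem 3.4 (v)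

Mochizuki, *Inter-universal Teichmüller theory I*, §3, Example 3.3 (iii), kurims May-2020 manuscript p. 79 l. 10–46
[claim: Mochizuki2012, status: disputed]: "(b) the category `D⊢_v` (respectively, `D^Θ_v`) may be reconstructed
category-theoretically from `C⊢_v` (respectively, `C^Θ_v`) [cf. [FrdI], Theorem 3.4, (v); [FrdII], Theorem 1.2, (i);
[FrdII], Example 1.3, (i); [AbsAnab], Theorem 1.1.1, (ii)]; (c) the category `D_v` may be reconstructed
category-theoretically from `F̲_v` [cf. [FrdI], Theorem 3.4, (v); [FrdII], Theorem 1.2, (i); [FrdII], Example 1.3, (i);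
[AbsAnab], Lemma 1.3.1]". abc-iut cell, WAVE-4 seat abc-iut-w4-d047 (gen 2); DAG node `IUTchI:Ex3.3(iii)`; the MERGE
DISCHARGE named as residual «L1 S1» in `plan/L5/SUBDAG-IUTchI-Ex33-Ex34.md` §B rows E33iii/b, E33iii/c.

PROOF-ONLY (no definitions). abc-iut-L5-t2 typed (b)(c) as the model-relative `Prop`s `GoodLocalFrobenioid.BasesFromC`,
`GoodLocalFrobenioid.DFromF` (`SplitFrobenioids.lean`): every self-equivalence of the Frobenioid descends, compatibly with the
structure functor, to a self-equivalence of its base (the Rmk. 3.2.1 (i) reading). For the REAL instances assembled from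
abc-iut-L1-t4's [FrdII] Example 1.1 kit (`GoodLocalFrobenioid.ofKit`, `GoodLocalFrobenioidOfKit.lean`; over the real
Galois coset bases: `GoodLocalFrobenioid.ofGalois`, `GoodLocalFrobenioidOfGalois.lean`) the Frobenioids `C⊢_v`, `C^Θ_v`,
`C_v` ARE `p_v`-adic Frobenioids ([FrdII] Ex. 1.1 (ii) model Frobenioids `PadicFrd.Datum.frobenioid`), and the printed
justification is now a kernel theorem of layer L1:

* [FrdI] Thm. 3.4 (v) over FSM-type bases — `FrdI.Thm34Sub.thm34v_FSM_holds` (abc-iut-L1-d8/d4, p413997: under (a)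
  standard type, (b) `HypB`, Frobenioids over FSM-type bases and (c) slim bases, an equivalence `Ψ : C₁ ⥲ C₂` induces a
  `1`-unique equivalence `Ψ^Base : D₁ ⥲ D₂` `1`-commuting with the projections);
* [FrdII] Thm. 1.2 (i) — every `p`-adic Frobenioid over an FSM-type base IS a Frobenioid of standard type
  (`PadicFrd.Datum.isFrobenioid_of_isOfFSMType`, `thm12_isOfStandardType_of_isOfFSMType`) and is NOT of group-like type
  (`PadicFrd.Datum.not_isZeroMonoid` + `ModelFrobenioid.data_isOfGroupLikeType_iff`), so that (b) `HypB` is vacuous.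

RESULTS. `padicFrobenioid_base_reconstructible`: for every `p`-adic Frobenioid datum `d` over a SLIM base `D` of FSM-type
and every self-equivalence `e` of `d.frobenioid` there is a self-equivalence `e'` of `D` with `Base ⋙ e' ≅ e ⋙ Base`. Hence
`basesFromC_ofKit` (Ex. 3.3 (iii)(b) at `ofKit`, hypotheses: `D⊢_v` slim and of FSM-type), `dFromF_ofKit` ((c), hypotheses:
`D_v` slim and of FSM-type), and over the REAL coset bases `basesFromC_ofGalois` / `dFromF_ofGalois`, where FSM-type is
DISCHARGED by `CosetCat.isOfFSMType` ([FrdII] Ex. 1.3 (i), `CosetCategoriesFSM.lean`) and the ONLY remaining hypothesis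
is the slimness of the coset category `𝓑(G_v)⁰` (resp. `𝓑(Π_v)⁰`) — print's hypothesis (c) of [FrdI] Thm. 3.4 (v), i.e.
the cited [AbsAnab] Thm. 1.1.1 (ii) / Lem. 1.3.1 (slimness of `G_v`, `Π_v`), consumed BY NAME as a hypothesis on the
category (no new Prop fact). Honest scope: the typed clauses are discharged AT NAMED INSTANCES only (they are schemas:
`BadLocalFrobenioidClaimsIndependence*.lean`); (a) is `GoodLocalFrobenioidOfKitQpReconstruction.lean` /
`ReconstructibleAlongCriterion.lean`; (d)(e) are not touched here. Nothing of the disputed series is asserted; typed ≠ proved.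
-/

-- `(PreFrobenioidData.ofFunctor Φ F).base` is `ModelFrobenioid.baseFunctor` only at default transparency (cf. the same
-- option in abc-iut-L1-d4's `PsiBaseEquivalence.lean`).
set_option backward.isDefEq.respectTransparency false

namespace Literature.IUT.HodgeTheaters

open CategoryTheory Literature.AlgebraicGeometry.Frobenioids Literature.AlgebraicGeometry.Frobenioids.PadicFrd
open Literature.AnabelianGeometry.SemiGraphs

universe u v

namespace GoodLocalFrobenioid

/-! ### The L1 input: bases of `p`-adic Frobenioids are reconstructible ([FrdI] Thm. 3.4 (v) + [FrdII] Thm. 1.2 (i)) -/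

section Padic

variable {D : Type u} [Category.{v} D] {p : ℕ} [Fact p.Prime] (d : Datum D p)

/-- The hypothesis bundle `StdHyp` of [FrdI] Thm. 3.4 (iii)–(v) (FSM-type variant) holds for a `p`-adic Frobenioid over
an FSM-type base and ANY self-equivalence: it is a Frobenioid of standard type ([FrdII] Thm. 1.2 (i)) and hypothesis (b)
is vacuous because a `p`-adic Frobenioid is not of group-like type. [claim: Mochizuki2012, status: disputed] -/
theorem padicFrobenioid_stdHyp (hD : IsOfFSMType D) (e : d.frobenioid ≌ d.frobenioid) :
    FrdI.Thm34Sub.StdHyp d.structureFunctor d.structureFunctor e where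
  isFrobenioid₁ := d.isFrobenioid_of_isOfFSMType hD
  isFrobenioid₂ := d.isFrobenioid_of_isOfFSMType hD
  fsm₁ := hD
  fsm₂ := hD
  standard₁ := d.thm12_isOfStandardType_of_isOfFSMType hD
  standard₂ := d.thm12_isOfStandardType_of_isOfFSMType hD
  hypB := fun hg _ =>
    absurd ((ModelFrobenioid.data_isOfGroupLikeType_iff d.Φ d.B d.divB).mp hg) d.not_isZeroMonoid

/-- **The base of a `p`-adic Frobenioid is reconstructible category-theoretically** ([FrdI] Thm. 3.4 (v) applied to
[FrdII] Ex. 1.1 (ii)): over a slim base `D` of FSM-type, every self-equivalence `e` of the `p`-adic Frobenioid `C`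
descends to a self-equivalence `e'` of `D` with `(C → D) ⋙ e' ≅ e ⋙ (C → D)`. [claim: Mochizuki2012, status: disputed] -/
theorem padicFrobenioid_base_reconstructible (hD : IsOfFSMType D) (hslim : IsSlim D)
    (e : d.frobenioid ≌ d.frobenioid) :
    ∃ e' : D ≌ D, Nonempty (ModelFrobenioid.baseFunctor d.Φ d.B d.divB ⋙ e'.functor ≅
      e.functor ⋙ ModelFrobenioid.baseFunctor d.Φ d.B d.divB) := by
  obtain ⟨ΨBase, ⟨hEq, ⟨I⟩, -⟩, -, -⟩ :=
    (FrdI.Thm34Sub.thm34v_FSM_holds d.structureFunctor d.structureFunctor e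
      (padicFrobenioid_stdHyp d hD e) hslim hslim).2.2
  haveI := hEq
  exact ⟨ΨBase.asEquivalence, ⟨I.symm⟩⟩

end Padic

/-! ### Example 3.3 (iii) (b)(c) at `ofKit` -/

section OfKit

variable {p : ℕ} [Fact p.Prime] {Dv Dd : Type u} [Category.{u} Dv] [Category.{u} Dd]
  (incl : Dd ⥤ Dv) (proj : Dv ⥤ Dd) (adj : proj ⊣ incl)
  (base : Dd ⥤ PadicFld.{u} p) (hloc : ∀ A : Dd, (base.obj A).IsPadicLocal)
  (hc : IsConnected Dd) (he : IsTotallyEpimorphic Dd) (hcV : IsConnected Dv) (heV : IsTotallyEpimorphic Dv)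
  (Kv : Type) [Field Kv] [ValuativeRel Kv] (hp : ((p : Kv)) ∈ PadicFrd.intNonzero Kv) [incl.Full] [incl.Faithful]

/-- **Ex. 3.3 (iii) (b) at `ofKit`**: "the category `D⊢_v` (respectively, `D^Θ_v`) may be reconstructed
category-theoretically from `C⊢_v` (respectively, `C^Θ_v`) [cf. [FrdI], Theorem 3.4, (v); [FrdII], Theorem 1.2, (i)
…]" — for every base `D⊢_v` that is SLIM and of FSM-type (print's hypotheses (c) of Thm. 3.4 (v) and of [FrdII]
Thm. 1.2 (i)), `C⊢_v`, `C^Θ_v` being abc-iut-L1-t4's REAL `p_v`-adic Frobenioids. [claim: Mochizuki2012, status: disputed] -/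
theorem basesFromC_ofKit (hfsm : IsOfFSMType Dd) (hslim : IsSlim Dd) :
    (ofKit incl proj adj base hloc hc he hcV heV Kv hp).BasesFromC :=
  ⟨fun e => padicFrobenioid_base_reconstructible (Datum.prim base hloc hc he) hfsm hslim e,
    fun e => padicFrobenioid_base_reconstructible (Datum.prim base hloc hc he) hfsm hslim e⟩

/-- **Ex. 3.3 (iii) (c) at `ofKit`**: "the category `D_v` may be reconstructed category-theoretically from `F̲_v`
[cf. [FrdI], Theorem 3.4, (v); [FrdII], Theorem 1.2, (i) …]" — for every base `D_v` that is SLIM and of FSM-type,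
`F̲_v = C_v` being the REAL `p_v`-adic Frobenioid of `Φ_{C_v} = ord(𝒪^▷)^pf` pulled back to `D_v`.
[claim: Mochizuki2012, status: disputed] -/
theorem dFromF_ofKit (hfsmV : IsOfFSMType Dv) (hslimV : IsSlim Dv) :
    (ofKit incl proj adj base hloc hc he hcV heV Kv hp).DFromF :=
  fun e => padicFrobenioid_base_reconstructible
    (Datum.perf (proj ⋙ base) (hlocOver proj base hloc) hcV heV) hfsmV hslimV e

end OfKit

/-! ### Example 3.3 (iii) (b)(c) over the REAL coset bases (`ofGalois`): FSM-type discharged, slimness by name -/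

section OfGalois

variable {p : ℕ} [Fact p.Prime] (d : GaloisValDatum.{u} p) {P : Type u} [Group P] [TopologicalSpace P]
  (aug : P →* d.Gal) (hc : Continuous aug) (hs : Function.Surjective aug) (ho : IsOpenMap aug)
  (Kv : Type) [Field Kv] [ValuativeRel Kv] (hp : ((p : Kv)) ∈ PadicFrd.intNonzero Kv)

/-- **Ex. 3.3 (iii) (b) over the REAL base `D⊢_v = 𝓑(G_v)⁰`** (small coset model `CosetCat Gal(Ω/K_v)`): the base is
reconstructible from `C⊢_v` (resp. `C^Θ_v`) as soon as `𝓑(G_v)⁰` is slim ([AbsAnab] Thm. 1.1.1 (ii): `G_v` slim —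
consumed BY NAME as a hypothesis on the coset category); FSM-type is [FrdII] Ex. 1.3 (i) (`CosetCat.isOfFSMType`).
[claim: Mochizuki2012, status: disputed] -/
theorem basesFromC_ofGalois [IsTopologicalGroup d.Gal] (hslim : IsSlim (CosetCat d.Gal)) :
    (ofGalois d aug hc hs ho Kv hp).BasesFromC :=
  haveI := CosetCat.pull_full aug hc hs
  haveI := CosetCat.pull_faithful aug hc hs
  basesFromC_ofKit _ _ _ _ _ _ _ _ _ Kv hp CosetCat.isOfFSMType hslim

/-- **Ex. 3.3 (iii) (c) over the REAL base `D_v = 𝓑(Π_v)⁰`** (small coset model `CosetCat Π_v`): `D_v` is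
reconstructible from `F̲_v = C_v` as soon as `𝓑(Π_v)⁰` is slim ([AbsAnab] Lem. 1.3.1: `Π_v` slim — BY NAME);
FSM-type is `CosetCat.isOfFSMType`. [claim: Mochizuki2012, status: disputed] -/
theorem dFromF_ofGalois [IsTopologicalGroup P] (hslimV : IsSlim (CosetCat P)) :
    (ofGalois d aug hc hs ho Kv hp).DFromF :=
  haveI := CosetCat.pull_full aug hc hs
  haveI := CosetCat.pull_faithful aug hc hs
  dFromF_ofKit _ _ _ _ _ _ _ _ _ Kv hp CosetCat.isOfFSMType hslimV

end OfGalois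

/-! ### v2 (append): UNCONDITIONAL at the witnesses `ofPadicGalois p` — slimness of `𝓑(G_{ℚ_p})⁰` discharged -/

section OfPadicGalois

variable (p : ℕ) [Fact p.Prime]

/-- `D⊢_v = D_v = 𝓑(G_{ℚ_p})⁰` (the coset category of `Gal(ℚ̄_p/ℚ_p)` with its Krull topology) IS a slim category:
`G_{ℚ_p}` is slim ([AbsAnab] Thm. 1.1.1 (ii), abc-iut-L4's `IsSubpadicFor.isSlimGroup_absoluteGaloisGroup`) and
"`Π` slim ⇒ `𝓑(Π)⁰` slim" ([FrdI] §0, abc-iut-L1-t4's `CosetCat.isSlim_of_isSlimGroup` /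
`PadicFrd.isSlim_cosetCat_galQp`). [cite: MochizukiFrdII2008, Ex 1.1 (i) p.7] -/
theorem isSlim_cosetCat_ofPadic_gal : IsSlim (CosetCat (GaloisValDatum.ofPadic p).Gal) :=
  PadicFrd.isSlim_cosetCat_galQp p

/-- **Ex. 3.3 (iii) (b) at the witness `ofPadicGalois p` — UNCONDITIONAL**: over the REAL base
`D⊢_v = 𝓑(G_{ℚ_p})⁰`, the base is reconstructible category-theoretically from the REAL `p`-adic Frobenioid `C⊢_v`
(resp. `C^Θ_v`): [FrdI] Thm. 3.4 (v) with ALL its hypotheses — (a) standard type ([FrdII] Thm. 1.2 (i)), (b) vacuous,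
FSM-type ([FrdII] Ex. 1.3 (i)), (c) slim base ([AbsAnab] Thm. 1.1.1 (ii) + [FrdI] §0) — kernel-discharged.
[claim: Mochizuki2012, status: disputed] -/
theorem basesFromC_ofPadicGalois : (ofPadicGalois p).BasesFromC :=
  basesFromC_ofGalois (GaloisValDatum.ofPadic p) (MonoidHom.id _) continuous_id Function.surjective_id IsOpenMap.id
    ℚ_[p] (PadicFrd.p_mem_intNonzero p) (isSlim_cosetCat_ofPadic_gal p)

/-- **Ex. 3.3 (iii) (c) at the witness `ofPadicGalois p` — UNCONDITIONAL**: `D_v = 𝓑(Π_v)⁰` (here `Π_v := G_{ℚ_p}`,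
the labelled degenerate choice of the witness) is reconstructible category-theoretically from the REAL `F̲_v = C_v`.
[claim: Mochizuki2012, status: disputed] -/
theorem dFromF_ofPadicGalois : (ofPadicGalois p).DFromF :=
  dFromF_ofGalois (GaloisValDatum.ofPadic p) (MonoidHom.id _) continuous_id Function.surjective_id IsOpenMap.id
    ℚ_[p] (PadicFrd.p_mem_intNonzero p) (isSlim_cosetCat_ofPadic_gal p)

end OfPadicGalois

end GoodLocalFrobenioid

end Literature.IUT.HodgeTheaters
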